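import Summits.CriticalPhenomena.PercolationContinuityZ3.Theorems.PercNearOneGluingNoHeavyLowerTailCubicThreePointHubEdge
import Summits.CriticalPhenomena.PercolationContinuityZ3.Theorems.PercNearOneGluingNoHeavyLowerTailCubicThreePointSeriesParallel
import Mathlib.Tactic.Ring
import Mathlib.Tactic.Linarith
import Mathlib.Tactic.Positivity
import HarnessLib

/-!
# `NoHeavyLowerTail` (stmt-CriticalPhenomena-4575) — the sharp cubic row on the HUB-EXTENDED series–parallel class

Support file (prover prim-gen-kcluster gen 10, k-cluster line; `--supports stmt-CriticalPhenomena-4575`).  Pure real algebra; no measure theory, no named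
facts, no sorries.  Packaging of `…CubicThreePointSeriesParallel` (`SPLaw`, `SPLaw.sharp`: every series–parallel three-point law satisfies `AG ≥ 0` and
`Hmax3 = max(Ha,Hb) ≥ 0`) with the HUB-EDGE THEOREM `CubicThreePointHub.hubEdge_sharp` (`…CubicThreePointHubEdge`): the class `HubLaw` generated by all
series–parallel laws and all hub-edge laws (the law of `K_{2,3} +` hub edge: two hubs with arms `a,b,c` / `A,B,C`, hub–hub edge `p`) under parallel composition
(`join`) and the meet composition is still inside `{AG ≥ 0, max(Ha,Hb) ≥ 0}` (`HubLaw.sharp`), by the K3-semigroup theorem `maxH_join_nonneg` / `maxH_meet_nonneg`.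
By the hub-partition representation (conditioning on the cluster partition of the Steiner part; memo run/shared/lean/prim/prim-gen-kcluster/KCLUSTER-gen10.md §2)
this class contains the three-point law of every weighted graph whose Steiner part `G − {a,b,c}` has connected components of size `≤ 2` — the first class of
graphs beyond series–parallel on which the sharp row `P(abc)² ≥ P(ab)P(ac)P(bc) ∨ P(a|b|c)² ≥ ∏ P(i ∤ rest)` is a theorem.  Cell convention
`(q,u₁,u₂,u₃,t) = (P(a|b|c),P(ab|c),P(ac|b),P(bc|a),P(abc))`, forms of `…CubicThreePointTerminalClosure`.
[cite: Gladkov2024StrongFKG, Cor. 4.2 (AG)]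
-/

namespace Summit.CriticalPhenomena.PercolationContinuityZ3.Theorems

namespace CubicThreePointHub

open CubicThreePointTerminal CubicThreePointJoin

/-- The hub-extended series–parallel class of three-point laws: series–parallel laws, hub-edge laws (`K_{2,3} +` hub edge, arms and hub edge in
`[0,1]`), closed under parallel composition and meet. [folklore] -/
inductive HubLaw : ℝ → ℝ → ℝ → ℝ → ℝ → Prop
  | sp {q u₁ u₂ u₃ t : ℝ} (h : SPLaw q u₁ u₂ u₃ t) : HubLaw q u₁ u₂ u₃ t
  | hubEdge {p a b c A B C : ℝ} (hp₀ : 0 ≤ p) (hp₁ : p ≤ 1) (ha₀ : 0 ≤ a) (ha₁ : a ≤ 1) (hb₀ : 0 ≤ b) (hb₁ : b ≤ 1) (hc₀ : 0 ≤ c) (hc₁ : c ≤ 1)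
      (hA₀ : 0 ≤ A) (hA₁ : A ≤ 1) (hB₀ : 0 ≤ B) (hB₁ : B ≤ 1) (hC₀ : 0 ≤ C) (hC₁ : C ≤ 1) :
      HubLaw ((1 - p) * ((1 - (a * b + a * c + b * c) + 2 * (a * b * c)) * (1 - (A * B + A * C + B * C) + 2 * (A * B * C))) + p * (1 - ((a
        + A - a * A) * (b + B - b * B) + (a + A - a * A) * (c + C - c * C) + (b + B - b * B) * (c + C - c * C)) + 2 * ((a + A - a * A) * (b
        + B - b * B) * (c + C - c * C))))
        ((1 - p) * ((1 - (a * b + a * c + b * c) + 2 * (a * b * c)) * (A * B * (1 - C)) + a * b * (1 - c) * (1 - (A * B + A * C + B * C)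
        + 2 * (A * B * C)) + a * b * (1 - c) * (A * B * (1 - C))) + p * ((a + A - a * A) * (b + B - b * B) * (1 - (c + C - c * C))))
        ((1 - p) * ((1 - (a * b + a * c + b * c) + 2 * (a * b * c)) * (A * C * (1 - B)) + a * c * (1 - b) * (1 - (A * B + A * C + B * C)
        + 2 * (A * B * C)) + a * c * (1 - b) * (A * C * (1 - B))) + p * ((a + A - a * A) * (c + C - c * C) * (1 - (b + B - b * B))))
        ((1 - p) * ((1 - (a * b + a * c + b * c) + 2 * (a * b * c)) * (B * C * (1 - A)) + b * c * (1 - a) * (1 - (A * B + A * C + B * C)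
        + 2 * (A * B * C)) + b * c * (1 - a) * (B * C * (1 - A))) + p * ((b + B - b * B) * (c + C - c * C) * (1 - (a + A - a * A))))
        ((1 - p) * (a * b * c * ((1 - (A * B + A * C + B * C) + 2 * (A * B * C)) + A * B * (1 - C) + A * C * (1 - B) + B * C * (1 - A) + A * B * C)
        + A * B * C * ((1 - (a * b + a * c + b * c) + 2 * (a * b * c)) + a * b * (1 - c) + a * c * (1 - b) + b * c * (1 - a))
       
        + (a * b * (1 - c) * (A * C * (1 - B) + B * C * (1 - A)) + a * c * (1 - b) * (A * B * (1 - C) + B * C * (1 - A))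
        + b * c * (1 - a) * (A * B * (1 - C) + A * C * (1 - B))))
        + p * ((a + A - a * A) * (b + B - b * B) * (c + C - c * C)))
  | join {q u₁ u₂ u₃ t Q v₁ v₂ v₃ T : ℝ} (hx : HubLaw q u₁ u₂ u₃ t) (hy : HubLaw Q v₁ v₂ v₃ T) :
      HubLaw (q * Q) (q * v₁ + u₁ * Q + u₁ * v₁) (q * v₂ + u₂ * Q + u₂ * v₂) (q * v₃ + u₃ * Q + u₃ * v₃)
        (t * (Q + v₁ + v₂ + v₃ + T) + T * (q + u₁ + u₂ + u₃) + (u₁ * (v₂ + v₃) + u₂ * (v₁ + v₃) + u₃ * (v₁ + v₂)))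
  | meet {q u₁ u₂ u₃ t Q v₁ v₂ v₃ T : ℝ} (hx : HubLaw q u₁ u₂ u₃ t) (hy : HubLaw Q v₁ v₂ v₃ T) :
      HubLaw (q * (T + v₁ + v₂ + v₃ + Q) + Q * (t + u₁ + u₂ + u₃) + (u₁ * (v₂ + v₃) + u₂ * (v₁ + v₃) + u₃ * (v₁ + v₂)))
        (t * v₁ + u₁ * T + u₁ * v₁) (t * v₂ + u₂ * T + u₂ * v₂) (t * v₃ + u₃ * T + u₃ * v₃) (t * T)

/-- Laws of the hub-extended class are probability vectors. [folklore] -/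
theorem HubLaw.cells {q u₁ u₂ u₃ t : ℝ} (h : HubLaw q u₁ u₂ u₃ t) :
    0 ≤ q ∧ 0 ≤ u₁ ∧ 0 ≤ u₂ ∧ 0 ≤ u₃ ∧ 0 ≤ t ∧ q + u₁ + u₂ + u₃ + t = 1 := by
  induction h with
  | sp h => exact h.cells
  | hubEdge hp₀ hp₁ ha₀ ha₁ hb₀ hb₁ hc₀ hc₁ hA₀ hA₁ hB₀ hB₁ hC₀ hC₁ =>
      exact hubEdge_cells hp₀ hp₁ ha₀ ha₁ hb₀ hb₁ hc₀ hc₁ hA₀ hA₁ hB₀ hB₁ hC₀ hC₁ rfl rfl rfl rfl rfl rfl rfl rfl rfl rfl rfl rfl rfl rfl rfl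
  | @join q u₁ u₂ u₃ t Q v₁ v₂ v₃ T hx hy ihx ihy =>
      obtain ⟨hq, hu₁, hu₂, hu₃, ht, hσ⟩ := ihx
      obtain ⟨hQ, hv₁, hv₂, hv₃, hT, hσ'⟩ := ihy
      refine ⟨by positivity, by positivity, by positivity, by positivity, by positivity, ?_⟩
      linear_combination (Q + v₁ + v₂ + v₃ + T) * hσ + hσ'
  | @meet q u₁ u₂ u₃ t Q v₁ v₂ v₃ T hx hy ihx ihy =>
      obtain ⟨hq, hu₁, hu₂, hu₃, ht, hσ⟩ := ihx
      obtain ⟨hQ, hv₁, hv₂, hv₃, hT, hσ'⟩ := ihy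
      refine ⟨by positivity, by positivity, by positivity, by positivity, by positivity, ?_⟩
      linear_combination (T + v₁ + v₂ + v₃ + Q) * hσ + hσ'

/-- **The sharp cubic row on the hub-extended series–parallel class.**  Every law of `HubLaw` satisfies `AG ≥ 0` and `max(Ha, Hb) ≥ 0`
(`Hmax3 = max(q,t)·AG − e₃ ≥ 0`): series–parallel laws by `SPLaw.sharp`, hub-edge laws by `hubEdge_sharp`, compositions by the K3-semigroup theorem. [folklore] -/
theorem HubLaw.sharp {q u₁ u₂ u₃ t : ℝ} (h : HubLaw q u₁ u₂ u₃ t) :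
    0 ≤ AG q u₁ u₂ u₃ t ∧ 0 ≤ max (Ha q u₁ u₂ u₃ t) (Hb q u₁ u₂ u₃ t) := by
  induction h with
  | sp h => exact h.sharp
  | hubEdge hp₀ hp₁ ha₀ ha₁ hb₀ hb₁ hc₀ hc₁ hA₀ hA₁ hB₀ hB₁ hC₀ hC₁ =>
      exact hubEdge_sharp hp₀ hp₁ ha₀ ha₁ hb₀ hb₁ hc₀ hc₁ hA₀ hA₁ hB₀ hB₁ hC₀ hC₁ rfl rfl rfl rfl rfl rfl rfl rfl rfl rfl rfl rfl rfl rfl rfl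
  | @join q u₁ u₂ u₃ t Q v₁ v₂ v₃ T hx hy ihx ihy =>
      obtain ⟨hq, hu₁, hu₂, hu₃, ht, -⟩ := hx.cells
      obtain ⟨hQ, hv₁, hv₂, hv₃, hT, -⟩ := hy.cells
      exact ⟨AG_join_nonneg hq hu₁ hu₂ hu₃ ht hQ hv₁ hv₂ hv₃ ihx.1 ihy.1 rfl rfl rfl rfl rfl,
        maxH_join_nonneg hq hu₁ hu₂ hu₃ ht hQ hv₁ hv₂ hv₃ hT ihx.1 ihy.1 ihx.2 ihy.2 rfl rfl rfl rfl rfl⟩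
  | @meet q u₁ u₂ u₃ t Q v₁ v₂ v₃ T hx hy ihx ihy =>
      obtain ⟨hq, hu₁, hu₂, hu₃, ht, -⟩ := hx.cells
      obtain ⟨hQ, hv₁, hv₂, hv₃, hT, -⟩ := hy.cells
      have h := maxH_meet_nonneg hq hu₁ hu₂ hu₃ ht hQ hv₁ hv₂ hv₃ hT ihx.1 ihy.1 ihx.2 ihy.2 rfl rfl rfl rfl rfl
      exact ⟨h.2, h.1⟩

end CubicThreePointHub

end Summit.CriticalPhenomena.PercolationContinuityZ3.Theorems
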